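import Mathlib
import Literature.Analysis.FunctionSpaces.BesselKPolya
import Literature.NumberTheory.Sieve.BombieriFriedlanderIwaniecKuznetsovTransforms
import HarnessLib

/-!
# The `K`-Bessel form of the minus transforms: `φ̌(t) = 8 cosh(πt) ∫₀^∞ K_{2it}(x) φ(x) dx/x`

Companion of `Literature.NumberTheory.Sieve.BombieriFriedlanderIwaniecKuznetsovTransforms`, which DEFINES
the Kuznetsov transforms `kuzTransforms` in the absolutely convergent Mehler–Sonine / Schläfli form
(`Tmi φ t = 4 ∫_ℝ cos(2tξ) P(sinh ξ) dξ`, `P(w) = ∫ cos(wx) φ(x) dx/x`) and proves the transform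
bounds (W).  Here we PROVE, for the minus sign, that these are the classical transforms: for `φ ∈ C¹`
with compact support in `(0, ∞)`,

* `kuzTransforms_Tmi_eq_besselK`: `Tmi φ t = 8 cosh(πt) ∫₀^∞ K_{2it}(x) φ(x) dx/x` (real `t`) —
  `φ̌(t)` of [Drappeau2017, (4.13)] (`κ = 0`), [DeshouillersIwaniec1982, (1.23)];
* `kuzTransforms_TmiX_eq_besselK`: `TmiX φ y = 8 cos(πy) ∫₀^∞ K_{2y}(x) φ(x) dx/x` (`|y| < 1/2`) —
  the value `φ̌(iy)` at an exceptional spectral parameter,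

with the tree's `besselK ν z = ∫₀^∞ e^{−z cosh u} cosh(νu) du` (`Literature.Analysis.FunctionSpaces.BesselK`).
This is the integrated form of Basset–Schläfli's `cosh(πt) K_{2it}(x) = ∫₀^∞ cos(x sinh ξ) cos(2tξ) dξ`
([Watson1944, §6.22]; [DeshouillersIwaniec1982, p. 264]: "we appeal to the formula
`K_{2ir}(x) = (ch πr)⁻¹ ∫₀^∞ cos(x sh ξ) cos(2rξ) dξ`"), whose right side is only conditionally
convergent; the proof below never uses conditionally convergent integrals.

## The argument

For `ρ = φ/x` (a `C¹` function supported in `[a, b] ⊂ (0, ∞)`, `Kuz.IsPosTest`) let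
`𝓛ρ(w) = ∫ e^{-xw} ρ(x) dx` (`Kuz.Lap`), an entire function of `w` (`differentiable_Lap`) with
`‖𝓛ρ(w)‖ ≤ ‖ρ'‖₁/‖w‖` on `Re w ≥ 0` (integration by parts, `norm_Lap_le_div`).  The entire function
`G_τ(z) = e^{τz} 𝓛ρ(cosh z)` is integrated over the rectangles `[-R, R] × [0, ±π/2]`
(Mathlib's `Complex.integral_boundary_rect_eq_zero_of_differentiableOn`); since
`Re cosh(x+iy) = cosh x cos y ≥ 0` and `‖cosh(x+iy)‖ ≥ |sinh x|`, the vertical sides are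
`O(e^{|Re τ|R}/sinh R) → 0` for `|Re τ| < 1` (`integral_Gτ_shift`).  With `cosh(x ± iπ/2) = ±i sinh x`
and `𝓛ρ(is) + 𝓛ρ(−is) = 2P(s)` this gives
`cos(πτ/2) ∫ e^{τx} 𝓛ρ(cosh x) dx = ∫ e^{τx} P(sinh x) dx` (`cos_mul_integral_Lap_cosh`), while Fubini and
the tree's `2K_ν(u) = ∫_ℝ e^{−u cosh x} e^{νx} dx` give `∫ e^{τx} 𝓛ρ(cosh x) dx = 2 ∫ K_τ(u) ρ(u) du`
(`integral_cexp_mul_Lap_cosh_eq_besselK`).  Take `τ = 2it` (`cos(iπt) = cosh πt`) and `τ = 2y`.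

Not here: the plus sign (`φ̃`, Mehler–Sonine for `J_{±2it}`), which needs Bessel functions of complex
order, absent from the tree.

## References
* [DeshouillersIwaniec1982] J.-M. Deshouillers, H. Iwaniec, Invent. Math. 70 (1982), (1.23), §7.1 p. 264.
* [Drappeau2017] S. Drappeau, Proc. LMS 114 (2017), §4.1.3 (4.13).
* [Watson1944] G. N. Watson, *A treatise on the theory of Bessel functions*, §6.22.
* [BatemanGrosswald1964] for the definition of `K_ν` used by the tree (`BesselK.lean`, `BesselKPolya.lean`).
-/

noncomputable section

open MeasureTheory Set Filter Real Complex
open scoped Topology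

namespace Literature.NumberTheory.Sieve.BFI.L1.Kuz

/-- `e^{|ξ|} ≤ 2 cosh ξ`. [folklore] -/
private theorem exp_abs_le_two_mul_cosh' (ξ : ℝ) : Real.exp |ξ| ≤ 2 * Real.cosh ξ := by
  rw [Real.cosh_eq]
  rcases le_or_gt 0 ξ with h | h
  · rw [abs_of_nonneg h]; linarith [Real.exp_pos (-ξ)]
  · rw [abs_of_neg h]; linarith [Real.exp_pos ξ]

/-- The Laplace transform `𝓛ρ(w) = ∫ e^{-xw} ρ(x) dx` of a compactly supported `ρ`. [folklore] -/
def Lap (ρ : ℝ → ℂ) (w : ℂ) : ℂ := ∫ x : ℝ, Complex.exp (-(x : ℂ) * w) * ρ x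

/-- Test functions for the bridge: `C¹`, compactly supported in `(0, ∞)`; we record the support
bounds `0 < a ≤ x ≤ b` explicitly. [folklore] -/
structure IsPosTest (ρ : ℝ → ℂ) (a b : ℝ) : Prop where
  pos : 0 < a
  le : a ≤ b
  smooth : ContDiff ℝ 1 ρ
  supp : ∀ x, ρ x ≠ 0 → x ∈ Set.Icc a b

namespace IsPosTest

variable {ρ : ℝ → ℂ} {a b : ℝ} (h : IsPosTest ρ a b)
include h

/-- `ρ` is continuous. [folklore] -/
private theorem continuous : Continuous ρ := h.smooth.continuous

/-- `ρ` vanishes off `[a, b]`. [folklore] -/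
theorem eq_zero {x : ℝ} (hx : x ∉ Set.Icc a b) : ρ x = 0 := by
  by_contra hne; exact hx (h.supp x hne)

/-- `ρ` has compact support. [folklore] -/
theorem hasCompactSupport : HasCompactSupport ρ :=
  HasCompactSupport.of_support_subset_isCompact isCompact_Icc fun x hx => h.supp x hx

/-- `ρ` is integrable. [folklore] -/
theorem integrable : Integrable ρ := h.continuous.integrable_of_hasCompactSupport h.hasCompactSupport

/-- `ρ'` is continuous. [folklore] -/
theorem continuous_deriv : Continuous (deriv ρ) := h.smooth.continuous_deriv le_rfl

/-- `ρ'` vanishes off `[a, b]`. [folklore] -/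
theorem deriv_eq_zero {x : ℝ} (hx : x ∉ Set.Icc a b) : deriv ρ x = 0 := by
  have hx' : x ∉ tsupport ρ := fun h' => hx ((closure_minimal (fun y hy => h.supp y hy) isClosed_Icc) h')
  by_contra hne
  exact hx' (support_deriv_subset (Function.mem_support.2 hne))

/-- `ρ'` has compact support. [folklore] -/
theorem hasCompactSupport_deriv : HasCompactSupport (deriv ρ) := h.hasCompactSupport.deriv

/-- `ρ'` is integrable. [folklore] -/
theorem integrable_deriv : Integrable (deriv ρ) :=
  h.continuous_deriv.integrable_of_hasCompactSupport h.hasCompactSupport_deriv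

omit h in
/-- On the support, `|e^{-xw}| ≤ 1` when `Re w ≥ 0` and `x ≥ 0`. [folklore] -/
theorem norm_cexp_neg_mul_le_one {x : ℝ} (hx : 0 ≤ x) {w : ℂ} (hw : 0 ≤ w.re) :
    ‖Complex.exp (-(x : ℂ) * w)‖ ≤ 1 := by
  rw [Complex.norm_exp]
  have : (-(x : ℂ) * w).re = -(x * w.re) := by simp [Complex.mul_re]
  rw [this, Real.exp_le_one_iff]
  nlinarith

/-- `𝓛ρ` is integrable-defined and bounded by `‖ρ‖₁` on `Re w ≥ 0`. [folklore] -/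
theorem norm_Lap_le {w : ℂ} (hw : 0 ≤ w.re) : ‖Lap ρ w‖ ≤ ∫ x, ‖ρ x‖ := by
  unfold Lap
  refine (norm_integral_le_integral_norm _).trans (integral_mono_of_nonneg
    (Eventually.of_forall fun x => norm_nonneg _) h.integrable.norm (Eventually.of_forall fun x => ?_))
  dsimp only
  rw [norm_mul]
  rcases le_or_gt a x with hx | hx
  · exact mul_le_of_le_one_left (norm_nonneg _) (norm_cexp_neg_mul_le_one (h.pos.le.trans hx) hw)
  · rw [h.eq_zero (fun hm => absurd hm.1 (not_le.2 hx)), norm_zero, mul_zero]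

end IsPosTest

namespace IsPosTest

variable {ρ : ℝ → ℂ} {a b : ℝ} (h : IsPosTest ρ a b)
include h

omit h in
/-- The full integrals over `ℝ` of functions vanishing off `[a, b]` are interval integrals over
`[a-1, b+1]`. [folklore] -/
theorem integral_eq_intervalIntegral_of_support {g : ℝ → ℂ} {a b : ℝ} (hab : a ≤ b)
    (hg : ∀ x, x ∉ Set.Icc a b → g x = 0) :
    ∫ x, g x = ∫ x in (a - 1)..(b + 1), g x := by
  rw [intervalIntegral.integral_of_le (by linarith)]
  symm
  apply setIntegral_eq_integral_of_forall_compl_eq_zero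
  intro x hx
  apply hg
  intro hm
  exact hx ⟨by linarith [hm.1], by linarith [hm.2]⟩

/-- **Integration by parts**: `w 𝓛ρ(w) = ∫ e^{-xw} ρ'(x) dx`. [folklore] -/
theorem mul_Lap_eq (w : ℂ) : w * Lap ρ w = ∫ x : ℝ, Complex.exp (-(x : ℂ) * w) * deriv ρ x := by
  have hab := h.le
  -- the derivative of `v(x) = e^{-xw}`
  have hv : ∀ x : ℝ, HasDerivAt (fun x : ℝ => Complex.exp (-(x : ℂ) * w)) (Complex.exp (-(x : ℂ) * w) * (-w)) x := by
    intro x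
    have h1 : HasDerivAt (fun x : ℝ => -(x : ℂ) * w) (-w) x := by
      simpa using ((Complex.ofRealCLM.hasDerivAt (x := x)).neg.mul_const w)
    exact (Complex.hasDerivAt_exp _).comp x h1
  have hu : ∀ x : ℝ, HasDerivAt ρ (deriv ρ x) x := fun x =>
    ((h.smooth.differentiable (by simp)) x).hasDerivAt
  have hibp := intervalIntegral.integral_mul_deriv_eq_deriv_mul (a := a - 1) (b := b + 1)
    (u := ρ) (v := fun x : ℝ => Complex.exp (-(x : ℂ) * w))
    (fun x _ => hu x) (fun x _ => hv x) (h.continuous_deriv.intervalIntegrable _ _)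
    (((Complex.continuous_exp.comp (by fun_prop)).mul continuous_const).intervalIntegrable _ _)
  have hρa : ρ (a - 1) = 0 := h.eq_zero (fun hm => by linarith [hm.1])
  have hρb : ρ (b + 1) = 0 := h.eq_zero (fun hm => by linarith [hm.2])
  rw [hρa, hρb, zero_mul, zero_mul, sub_zero, zero_sub] at hibp
  -- both sides as interval integrals
  have hL : Lap ρ w = ∫ x in (a - 1)..(b + 1), Complex.exp (-(x : ℂ) * w) * ρ x :=
    integral_eq_intervalIntegral_of_support hab (fun x hx => by rw [h.eq_zero hx, mul_zero])
  have hR : ∫ x : ℝ, Complex.exp (-(x : ℂ) * w) * deriv ρ x =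
      ∫ x in (a - 1)..(b + 1), Complex.exp (-(x : ℂ) * w) * deriv ρ x :=
    integral_eq_intervalIntegral_of_support hab (fun x hx => by rw [h.deriv_eq_zero hx, mul_zero])
  rw [hL, hR]
  have e1 : ∫ x in (a - 1)..(b + 1), ρ x * (Complex.exp (-(x : ℂ) * w) * (-w)) =
      -w * ∫ x in (a - 1)..(b + 1), Complex.exp (-(x : ℂ) * w) * ρ x := by
    rw [← intervalIntegral.integral_const_mul]
    congr 1; funext x; ring
  have e2 : ∫ x in (a - 1)..(b + 1), deriv ρ x * Complex.exp (-(x : ℂ) * w) =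
      ∫ x in (a - 1)..(b + 1), Complex.exp (-(x : ℂ) * w) * deriv ρ x := by
    congr 1; funext x; ring
  rw [e1, e2] at hibp
  linear_combination -hibp

/-- **Decay of `𝓛ρ`**: `‖𝓛ρ(w)‖ ≤ ‖ρ'‖₁/‖w‖` for `Re w ≥ 0`, `w ≠ 0`. [folklore] -/
theorem norm_Lap_le_div {w : ℂ} (hw : 0 ≤ w.re) (hw0 : w ≠ 0) :
    ‖Lap ρ w‖ ≤ (∫ x, ‖deriv ρ x‖) / ‖w‖ := by
  have hwn : 0 < ‖w‖ := norm_pos_iff.2 hw0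
  rw [le_div_iff₀ hwn, mul_comm, ← norm_mul, h.mul_Lap_eq w]
  refine (norm_integral_le_integral_norm _).trans (integral_mono_of_nonneg
    (Eventually.of_forall fun x => norm_nonneg _) h.integrable_deriv.norm (Eventually.of_forall fun x => ?_))
  dsimp only
  rw [norm_mul]
  rcases le_or_gt a x with hx | hx
  · exact mul_le_of_le_one_left (norm_nonneg _) (norm_cexp_neg_mul_le_one (h.pos.le.trans hx) hw)
  · rw [h.deriv_eq_zero (fun hm => absurd hm.1 (not_le.2 hx)), norm_zero, mul_zero]

omit h in
/-- `‖e^{-xw}‖ ≤ e^{|x| ‖w‖}`. [folklore] -/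
theorem norm_cexp_neg_mul_le (x : ℝ) (w : ℂ) : ‖Complex.exp (-(x : ℂ) * w)‖ ≤ Real.exp (|x| * ‖w‖) := by
  rw [Complex.norm_exp]
  apply Real.exp_le_exp.2
  have : (-(x : ℂ) * w).re = -(x * w.re) := by simp [Complex.mul_re]
  rw [this]
  have h1 : |x * w.re| ≤ |x| * ‖w‖ := by rw [abs_mul]; exact mul_le_mul_of_nonneg_left (Complex.abs_re_le_norm w) (abs_nonneg x)
  linarith [neg_abs_le (x * w.re)]

/-- **`𝓛ρ` is entire**, with derivative `−∫ x e^{-xw} ρ(x) dx`. [folklore] -/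
theorem differentiable_Lap : Differentiable ℂ (Lap ρ) := by
  intro w₀
  set F : ℂ → ℝ → ℂ := fun w x => Complex.exp (-(x : ℂ) * w) * ρ x with hF
  set F' : ℂ → ℝ → ℂ := fun w x => (-(x : ℂ)) * Complex.exp (-(x : ℂ) * w) * ρ x with hF'
  set bound : ℝ → ℝ := fun x => |x| * Real.exp (|x| * (‖w₀‖ + 1)) * ‖ρ x‖ with hbound
  have hFc : ∀ w, Continuous (F w) := fun w => by
    simp only [hF]; exact (Complex.continuous_exp.comp (by fun_prop)).mul h.continuous
  have hFm : ∀ w, AEStronglyMeasurable (F w) volume := fun w => (hFc w).aestronglyMeasurable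
  -- compact support of everything in sight
  have hsuppF : ∀ w, HasCompactSupport (F w) := fun w => h.hasCompactSupport.mul_left
  have hFi : Integrable (F w₀) := (hFc w₀).integrable_of_hasCompactSupport (hsuppF w₀)
  have hF'c : Continuous (F' w₀) := by
    simp only [hF']; exact ((Complex.continuous_ofReal.neg).mul (Complex.continuous_exp.comp (by fun_prop))).mul h.continuous
  have hF'm : AEStronglyMeasurable (F' w₀) volume := hF'c.aestronglyMeasurable
  have hbc : Continuous bound := by
    simp only [hbound]
    have := h.continuous
    fun_prop
  have hbsupp : HasCompactSupport bound := by
    simp only [hbound]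
    exact h.hasCompactSupport.norm.mul_left
  have hbi : Integrable bound := hbc.integrable_of_hasCompactSupport hbsupp
  have hbd : ∀ᵐ x ∂volume, ∀ w ∈ Metric.ball w₀ 1, ‖F' w x‖ ≤ bound x := by
    refine Eventually.of_forall fun x w hw => ?_
    simp only [hF', hbound, norm_mul, norm_neg, Complex.norm_real, Real.norm_eq_abs]
    have hw' : ‖w‖ ≤ ‖w₀‖ + 1 := by
      have := Metric.mem_ball.1 hw
      calc ‖w‖ = ‖w₀ + (w - w₀)‖ := by ring_nf
        _ ≤ ‖w₀‖ + ‖w - w₀‖ := norm_add_le _ _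
        _ ≤ ‖w₀‖ + 1 := by rw [← dist_eq_norm]; linarith
    have h1 : ‖Complex.exp (-(x : ℂ) * w)‖ ≤ Real.exp (|x| * (‖w₀‖ + 1)) :=
      (norm_cexp_neg_mul_le x w).trans (Real.exp_le_exp.2 (mul_le_mul_of_nonneg_left hw' (abs_nonneg x)))
    have h0 : 0 ≤ |x| := abs_nonneg x
    exact mul_le_mul (mul_le_mul_of_nonneg_left h1 h0) le_rfl (norm_nonneg _) (by positivity)
  have hdiff : ∀ᵐ x ∂volume, ∀ w ∈ Metric.ball w₀ 1, HasDerivAt (fun w => F w x) (F' w x) w := by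
    refine Eventually.of_forall fun x w _ => ?_
    simp only [hF, hF']
    have h1 : HasDerivAt (fun w : ℂ => -(x : ℂ) * w) (-(x : ℂ)) w := by
      simpa using (hasDerivAt_id w).const_mul (-(x : ℂ))
    have h2 := (Complex.hasDerivAt_exp _).comp w h1
    have h3 := h2.mul_const (ρ x)
    refine h3.congr_deriv ?_
    ring
  have key := hasDerivAt_integral_of_dominated_loc_of_deriv_le (μ := volume) (Metric.ball_mem_nhds w₀ zero_lt_one)
    (Eventually.of_forall hFm) hFi hF'm hbd hbi hdiff
  exact key.2.differentiableAt

end IsPosTest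

/-! ### Geometry of `cosh` on horizontal lines -/

/-- `cosh(x + iy) = cosh x cos y + i sinh x sin y`. [folklore] -/
theorem cosh_add_mul_I (x y : ℝ) :
    Complex.cosh ((x : ℂ) + (y : ℂ) * I) = (Real.cosh x * Real.cos y : ℝ) + (Real.sinh x * Real.sin y : ℝ) * I := by
  rw [Complex.cosh_add, Complex.cosh_mul_I, Complex.sinh_mul_I]
  push_cast
  rw [← Complex.ofReal_cosh, ← Complex.ofReal_sinh, ← Complex.ofReal_cos, ← Complex.ofReal_sin]
  ring

/-- `Re cosh(x + iy) = cosh x cos y`. [folklore] -/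
theorem cosh_add_mul_I_re (x y : ℝ) : (Complex.cosh ((x : ℂ) + (y : ℂ) * I)).re = Real.cosh x * Real.cos y := by
  rw [cosh_add_mul_I, Complex.add_re, Complex.ofReal_re, Complex.mul_re, Complex.ofReal_re, Complex.ofReal_im,
    Complex.I_re, Complex.I_im]
  ring

/-- `‖cosh(x + iy)‖ ≥ |sinh x|` (indeed `‖cosh(x+iy)‖² = sinh² x + cos² y`). [folklore] -/
theorem abs_sinh_le_norm_cosh (x y : ℝ) : |Real.sinh x| ≤ ‖Complex.cosh ((x : ℂ) + (y : ℂ) * I)‖ := by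
  rw [cosh_add_mul_I]
  have hsq : ‖((Real.cosh x * Real.cos y : ℝ) : ℂ) + ((Real.sinh x * Real.sin y : ℝ) : ℂ) * I‖ ^ 2 =
      (Real.sinh x) ^ 2 + (Real.cos y) ^ 2 := by
    rw [Complex.sq_norm, Complex.normSq_add_mul_I]
    have hc := Real.cosh_sq x
    have hs := Real.sin_sq_add_cos_sq y
    nlinarith [hc, hs]
  have h0 : 0 ≤ ‖((Real.cosh x * Real.cos y : ℝ) : ℂ) + ((Real.sinh x * Real.sin y : ℝ) : ℂ) * I‖ := norm_nonneg _
  have h1 : |Real.sinh x| ^ 2 ≤ ‖((Real.cosh x * Real.cos y : ℝ) : ℂ) + ((Real.sinh x * Real.sin y : ℝ) : ℂ) * I‖ ^ 2 := by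
    rw [hsq, sq_abs]; nlinarith [sq_nonneg (Real.cos y)]
  exact abs_le_of_sq_le_sq' (by nlinarith [abs_nonneg (Real.sinh x)]) h0 |>.2

/-- `cosh(x ± iπ/2) = ± i sinh x`. [folklore] -/
theorem cosh_add_pi_half_mul_I (x : ℝ) :
    Complex.cosh ((x : ℂ) + ((π / 2 : ℝ) : ℂ) * I) = I * (Real.sinh x : ℂ) := by
  rw [cosh_add_mul_I, Real.cos_pi_div_two, Real.sin_pi_div_two]; push_cast; ring

/-- `cosh(x - iπ/2) = -i sinh x`. [folklore] -/
theorem cosh_sub_pi_half_mul_I (x : ℝ) :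
    Complex.cosh ((x : ℂ) + ((-(π / 2) : ℝ) : ℂ) * I) = -I * (Real.sinh x : ℂ) := by
  rw [cosh_add_mul_I, Real.cos_neg, Real.sin_neg, Real.cos_pi_div_two, Real.sin_pi_div_two]; push_cast; ring

/-- `e^{-b|x|}` is integrable for `b > 0`. [folklore] -/
private theorem integrable_exp_neg_mul_abs' {b : ℝ} (hb : 0 < b) : Integrable fun ξ : ℝ => Real.exp (-b * |ξ|) := by
  have h1 : IntegrableOn (fun ξ : ℝ => Real.exp (-b * |ξ|)) (Set.Ioi 0) := by
    refine (integrableOn_exp_mul_Ioi (by linarith : -b < 0) 0).congr_fun (fun ξ hξ => ?_) measurableSet_Ioi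
    rw [abs_of_pos hξ]
  have h2 : IntegrableOn (fun ξ : ℝ => Real.exp (-b * |ξ|)) (Set.Iic 0) := by
    refine (integrableOn_exp_mul_Iic hb 0).congr_fun (fun ξ hξ => ?_) measurableSet_Iic
    rw [abs_of_nonpos hξ]; ring_nf
  have := h2.union h1
  rwa [Set.Iic_union_Ioi, integrableOn_univ] at this

/-! ### The contour integrals -/

namespace IsPosTest

variable {ρ : ℝ → ℂ} {a b : ℝ} (h : IsPosTest ρ a b)
include h

omit h in
/-- The entire function `G_τ(z) = e^{τz} 𝓛ρ(cosh z)`. [folklore] -/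
def Gτ (ρ : ℝ → ℂ) (τ z : ℂ) : ℂ := Complex.exp (τ * z) * Lap ρ (Complex.cosh z)

/-- `G_τ` is entire. [folklore] -/
theorem differentiable_Gτ (τ : ℂ) : Differentiable ℂ (Gτ ρ τ) := by
  unfold Gτ
  exact (Complex.differentiable_exp.comp (differentiable_id.const_mul τ)).mul
    (h.differentiable_Lap.comp Complex.differentiable_cosh)

/-- The bound on vertical sides: for `|y| ≤ π/2` and `x ≠ 0`,
`‖G_τ(x + iy)‖ ≤ e^{|Re τ||x| + |Im τ| π/2} ‖ρ'‖₁/|sinh x|`. [folklore] -/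
theorem norm_Gτ_vertical_le (τ : ℂ) {x y : ℝ} (hx : x ≠ 0) (hy : |y| ≤ π / 2) :
    ‖Gτ ρ τ ((x : ℂ) + (y : ℂ) * I)‖ ≤
      Real.exp (|τ.re| * |x| + |τ.im| * (π / 2)) * ((∫ u, ‖deriv ρ u‖) / |Real.sinh x|) := by
  unfold Gτ
  rw [norm_mul]
  have hcos : 0 ≤ Real.cos y := Real.cos_nonneg_of_mem_Icc ⟨by linarith [abs_le.1 hy |>.1], (abs_le.1 hy).2⟩
  have hre : 0 ≤ (Complex.cosh ((x : ℂ) + (y : ℂ) * I)).re := by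
    rw [cosh_add_mul_I_re]; exact mul_nonneg (Real.cosh_pos x).le hcos
  have hsx : 0 < |Real.sinh x| := abs_pos.2 (Real.sinh_ne_zero.2 hx)
  have hne : Complex.cosh ((x : ℂ) + (y : ℂ) * I) ≠ 0 := by
    intro h0
    have := abs_sinh_le_norm_cosh x y
    rw [h0, norm_zero] at this
    linarith
  have h1 := h.norm_Lap_le_div hre hne
  have h2 : (∫ u, ‖deriv ρ u‖) / ‖Complex.cosh ((x : ℂ) + (y : ℂ) * I)‖ ≤ (∫ u, ‖deriv ρ u‖) / |Real.sinh x| :=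
    div_le_div_of_nonneg_left (integral_nonneg fun u => norm_nonneg _) hsx (abs_sinh_le_norm_cosh x y)
  have h3 : ‖Complex.exp (τ * ((x : ℂ) + (y : ℂ) * I))‖ ≤ Real.exp (|τ.re| * |x| + |τ.im| * (π / 2)) := by
    rw [Complex.norm_exp]
    apply Real.exp_le_exp.2
    have e : (τ * ((x : ℂ) + (y : ℂ) * I)).re = τ.re * x - τ.im * y := by
      simp [Complex.mul_re]
    rw [e]
    have i1 : τ.re * x ≤ |τ.re| * |x| := by rw [← abs_mul]; exact le_abs_self _
    have i2 : -(τ.im * y) ≤ |τ.im| * (π / 2) := by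
      calc -(τ.im * y) ≤ |τ.im * y| := neg_le_abs _
        _ = |τ.im| * |y| := abs_mul _ _
        _ ≤ |τ.im| * (π / 2) := mul_le_mul_of_nonneg_left hy (abs_nonneg _)
    linarith
  exact mul_le_mul h3 (h1.trans h2) (norm_nonneg _) (Real.exp_pos _).le

/-- The vertical sides tend to `0`: `∫₀^{±π/2} G_τ(±R + iy) dy → 0` as `R → ∞`, for `|Re τ| < 1`.
We record the quantitative bound for `R ≥ 1`. [folklore] -/
theorem norm_integral_vertical_le (τ : ℂ) {R : ℝ} (hR : 1 ≤ R) (σ : ℝ) (hσ : σ = 1 ∨ σ = -1) (θ : ℝ)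
    (hθ : θ = π / 2 ∨ θ = -(π / 2)) :
    ‖∫ y in (0 : ℝ)..θ, Gτ ρ τ (((σ * R : ℝ) : ℂ) + (y : ℂ) * I)‖ ≤
      (π / 2) * (Real.exp (|τ.re| * R + |τ.im| * (π / 2)) * ((∫ u, ‖deriv ρ u‖) / Real.sinh R)) := by
  have hR0 : 0 < R := by linarith
  have hx : (σ * R : ℝ) ≠ 0 := by rcases hσ with rfl | rfl <;> simp [hR0.ne']
  have habs : |σ * R| = R := by rcases hσ with rfl | rfl <;> simp [abs_of_pos hR0]
  have hsinh : |Real.sinh (σ * R)| = Real.sinh R := by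
    rcases hσ with rfl | rfl
    · rw [one_mul, abs_of_pos (Real.sinh_pos_iff.2 hR0)]
    · rw [neg_one_mul, Real.sinh_neg, abs_neg, abs_of_pos (Real.sinh_pos_iff.2 hR0)]
  set C := Real.exp (|τ.re| * R + |τ.im| * (π / 2)) * ((∫ u, ‖deriv ρ u‖) / Real.sinh R) with hC
  have hbd : ∀ y ∈ Set.uIoc (0 : ℝ) θ, ‖Gτ ρ τ (((σ * R : ℝ) : ℂ) + (y : ℂ) * I)‖ ≤ C := by
    intro y hy
    have hyabs : |y| ≤ π / 2 := by
      have hπ := Real.pi_pos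
      rcases hθ with rfl | rfl
      · rw [Set.uIoc_of_le (by positivity)] at hy
        rw [abs_of_pos hy.1]; exact hy.2
      · rw [Set.uIoc_of_ge (by linarith)] at hy
        rw [abs_of_nonpos hy.2]; linarith [hy.1]
    have := h.norm_Gτ_vertical_le τ hx hyabs
    rwa [habs, hsinh] at this
  have := intervalIntegral.norm_integral_le_of_norm_le_const hbd
  refine this.trans ?_
  have hθabs : |θ - 0| = π / 2 := by
    rcases hθ with rfl | rfl
    · rw [sub_zero, abs_of_pos (by positivity)]
    · rw [sub_zero, abs_neg, abs_of_pos (by positivity)]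
  rw [hθabs]; linarith [le_refl (C * (π / 2))]

/-! ### The horizontal lines: integrability -/

/-- `‖𝓛ρ(cosh x)‖ ≤ 2 ‖ρ'‖₁ e^{-|x|}`. [folklore] -/
theorem norm_Lap_cosh_le (x : ℝ) : ‖Lap ρ (Real.cosh x : ℂ)‖ ≤ 2 * (∫ u, ‖deriv ρ u‖) * Real.exp (-|x|) := by
  have hc := Real.cosh_pos x
  have h1 := h.norm_Lap_le_div (w := (Real.cosh x : ℂ)) (by simp [hc.le]) (by exact_mod_cast hc.ne')
  rw [Complex.norm_real, Real.norm_eq_abs, abs_of_pos hc] at h1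
  refine h1.trans ?_
  rw [div_eq_mul_inv]
  have h2 : (Real.cosh x)⁻¹ ≤ 2 * Real.exp (-|x|) := by
    rw [inv_le_comm₀ hc (by positivity), Real.exp_neg]
    have e : (2 * (Real.exp |x|)⁻¹)⁻¹ = Real.exp |x| / 2 := by field_simp
    rw [e, Real.cosh_eq]
    rcases le_or_gt 0 x with h0 | h0
    · rw [abs_of_nonneg h0]; linarith [Real.exp_pos (-x)]
    · rw [abs_of_neg h0]; linarith [Real.exp_pos x]
  have h0 : 0 ≤ ∫ u, ‖deriv ρ u‖ := integral_nonneg fun u => norm_nonneg _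
  nlinarith

/-- `‖𝓛ρ(±i sinh x)‖ ≤ (e ‖ρ‖₁ + 4 ‖ρ'‖₁) e^{-|x|}`. [folklore] -/
theorem norm_Lap_I_sinh_le (x : ℝ) (σ : ℂ) (hσ : σ = I ∨ σ = -I) :
    ‖Lap ρ (σ * (Real.sinh x : ℂ))‖ ≤ (Real.exp 1 * (∫ u, ‖ρ u‖) + 4 * (∫ u, ‖deriv ρ u‖)) * Real.exp (-|x|) := by
  have hre : (σ * (Real.sinh x : ℂ)).re = 0 := by rcases hσ with rfl | rfl <;> simp
  have hn0 : 0 ≤ ∫ u, ‖ρ u‖ := integral_nonneg fun u => norm_nonneg _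
  have hn1 : 0 ≤ ∫ u, ‖deriv ρ u‖ := integral_nonneg fun u => norm_nonneg _
  have hnorm : ‖σ * (Real.sinh x : ℂ)‖ = |Real.sinh x| := by
    rw [norm_mul, Complex.norm_real, Real.norm_eq_abs]
    rcases hσ with rfl | rfl <;> simp
  rcases le_or_gt 1 |x| with hx | hx
  · -- decay from integration by parts
    have hs0 : σ * (Real.sinh x : ℂ) ≠ 0 := by
      rw [← norm_pos_iff, hnorm]; exact abs_pos.2 (Real.sinh_ne_zero.2 (by intro h0; rw [h0, abs_zero] at hx; linarith))
    have h1 := h.norm_Lap_le_div (le_of_eq hre.symm) hs0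
    rw [hnorm] at h1
    -- `1/|sinh x| ≤ 4 e^{-|x|}`
    have h2 : (|Real.sinh x|)⁻¹ ≤ 4 * Real.exp (-|x|) := by
      have hs : Real.exp |x| / 4 ≤ |Real.sinh x| := by
        -- from `|sinh x| = sinh |x| ≥ e^{|x|}/4` for `|x| ≥ 1`
        have habs : |Real.sinh x| = Real.sinh |x| := by
          rcases le_or_gt 0 x with h0 | h0
          · rw [abs_of_nonneg h0, abs_of_nonneg (Real.sinh_nonneg_iff.2 h0)]
          · rw [abs_of_neg h0, abs_of_neg (Real.sinh_neg_iff.2 h0), Real.sinh_neg]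
        rw [habs, Real.sinh_eq]
        have e2 : (2 : ℝ) ≤ Real.exp (2 * |x|) := by have := Real.add_one_le_exp (2 * |x|); linarith
        have e3 : Real.exp (2 * |x|) = Real.exp |x| * Real.exp |x| := by rw [← Real.exp_add]; ring_nf
        have e4 : Real.exp (-|x|) * Real.exp |x| = 1 := by rw [← Real.exp_add]; simp
        nlinarith [Real.exp_pos (-|x|), Real.exp_pos |x|]
      have hpos : 0 < |Real.sinh x| := lt_of_lt_of_le (by positivity) hs
      rw [inv_le_comm₀ hpos (by positivity), Real.exp_neg]
      have e : (4 * (Real.exp |x|)⁻¹)⁻¹ = Real.exp |x| / 4 := by field_simp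
      rwa [e]
    have he := Real.exp_pos (-|x|)
    have hextra : 0 ≤ Real.exp 1 * (∫ u, ‖ρ u‖) * Real.exp (-|x|) := by positivity
    calc ‖Lap ρ (σ * (Real.sinh x : ℂ))‖ ≤ (∫ u, ‖deriv ρ u‖) / |Real.sinh x| := h1
      _ = (∫ u, ‖deriv ρ u‖) * (|Real.sinh x|)⁻¹ := div_eq_mul_inv _ _
      _ ≤ (∫ u, ‖deriv ρ u‖) * (4 * Real.exp (-|x|)) := mul_le_mul_of_nonneg_left h2 hn1
      _ = 4 * (∫ u, ‖deriv ρ u‖) * Real.exp (-|x|) := by ring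
      _ ≤ _ := by nlinarith
  · -- the trivial bound
    have h1 := h.norm_Lap_le (le_of_eq hre.symm)
    have h2 : (1 : ℝ) ≤ Real.exp 1 * Real.exp (-|x|) := by
      rw [← Real.exp_add]; exact Real.one_le_exp (by linarith)
    calc ‖Lap ρ (σ * (Real.sinh x : ℂ))‖ ≤ (∫ u, ‖ρ u‖) * 1 := by rw [mul_one]; exact h1
      _ ≤ (∫ u, ‖ρ u‖) * (Real.exp 1 * Real.exp (-|x|)) := mul_le_mul_of_nonneg_left h2 hn0
      _ ≤ _ := by nlinarith [Real.exp_pos (-|x|)]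

omit h in
/-- `‖e^{τx}‖ ≤ e^{|Re τ| |x|}` for real `x`. [folklore] -/
theorem norm_cexp_mul_ofReal_le (τ : ℂ) (x : ℝ) : ‖Complex.exp (τ * x)‖ ≤ Real.exp (|τ.re| * |x|) := by
  rw [Complex.norm_exp]
  apply Real.exp_le_exp.2
  have : (τ * (x : ℂ)).re = τ.re * x := by simp
  rw [this, ← abs_mul]; exact le_abs_self _

/-- Integrability of `G_τ` on the three horizontal lines `Im z ∈ {0, ±π/2}` (`|Re τ| < 1`). [folklore] -/
theorem integrable_Gτ_line (τ : ℂ) (hτ : |τ.re| < 1) (θ : ℝ) (hθ : θ = 0 ∨ θ = π / 2 ∨ θ = -(π / 2)) :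
    Integrable fun x : ℝ => Gτ ρ τ ((x : ℂ) + (θ : ℂ) * I) := by
  have hb : 0 < 1 - |τ.re| := by linarith
  set C : ℝ := Real.exp (|τ.im| * (π / 2)) * (2 * (∫ u, ‖deriv ρ u‖) + (Real.exp 1 * (∫ u, ‖ρ u‖) + 4 * (∫ u, ‖deriv ρ u‖)))
  have hcont : Continuous fun x : ℝ => Gτ ρ τ ((x : ℂ) + (θ : ℂ) * I) := by
    have hG := (h.differentiable_Gτ τ).continuous
    exact hG.comp (by fun_prop)
  refine ((integrable_exp_neg_mul_abs' hb).const_mul C).mono' hcont.aestronglyMeasurable ?_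
  refine Eventually.of_forall fun x => ?_
  unfold Gτ
  rw [norm_mul]
  -- the exponential factor
  have hexp : ‖Complex.exp (τ * ((x : ℂ) + (θ : ℂ) * I))‖ ≤ Real.exp (|τ.im| * (π / 2)) * Real.exp (|τ.re| * |x|) := by
    rw [Complex.norm_exp, ← Real.exp_add]
    apply Real.exp_le_exp.2
    have e : (τ * ((x : ℂ) + (θ : ℂ) * I)).re = τ.re * x - τ.im * θ := by simp [Complex.mul_re]
    rw [e]
    have i1 : τ.re * x ≤ |τ.re| * |x| := by rw [← abs_mul]; exact le_abs_self _
    have hθabs : |θ| ≤ π / 2 := by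
      have hπ := Real.pi_pos
      rcases hθ with rfl | rfl | rfl
      · simp; positivity
      · rw [abs_of_pos (by positivity)]
      · rw [abs_neg, abs_of_pos (by positivity)]
    have i2 : -(τ.im * θ) ≤ |τ.im| * (π / 2) := by
      calc -(τ.im * θ) ≤ |τ.im * θ| := neg_le_abs _
        _ = |τ.im| * |θ| := abs_mul _ _
        _ ≤ |τ.im| * (π / 2) := mul_le_mul_of_nonneg_left hθabs (abs_nonneg _)
    linarith
  -- the Laplace factor
  have hLap : ‖Lap ρ (Complex.cosh ((x : ℂ) + (θ : ℂ) * I))‖ ≤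
      (2 * (∫ u, ‖deriv ρ u‖) + (Real.exp 1 * (∫ u, ‖ρ u‖) + 4 * (∫ u, ‖deriv ρ u‖))) * Real.exp (-|x|) := by
    have hn0 : 0 ≤ ∫ u, ‖ρ u‖ := integral_nonneg fun u => norm_nonneg _
    have hn1 : 0 ≤ ∫ u, ‖deriv ρ u‖ := integral_nonneg fun u => norm_nonneg _
    have he := Real.exp_pos (-|x|)
    have hA : 0 ≤ 2 * (∫ u, ‖deriv ρ u‖) * Real.exp (-|x|) := by positivity
    have hB : 0 ≤ (Real.exp 1 * (∫ u, ‖ρ u‖) + 4 * (∫ u, ‖deriv ρ u‖)) * Real.exp (-|x|) := by positivity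
    rcases hθ with rfl | rfl | rfl
    · have : Complex.cosh ((x : ℂ) + ((0 : ℝ) : ℂ) * I) = (Real.cosh x : ℂ) := by
        rw [Complex.ofReal_zero, zero_mul, add_zero, Complex.ofReal_cosh]
      rw [this]
      have := h.norm_Lap_cosh_le x
      linarith
    · rw [cosh_add_pi_half_mul_I]
      have := h.norm_Lap_I_sinh_le x I (Or.inl rfl)
      linarith
    · rw [cosh_sub_pi_half_mul_I]
      have := h.norm_Lap_I_sinh_le x (-I) (Or.inr rfl)
      linarith
  have h0 : 0 ≤ Real.exp (|τ.im| * (π / 2)) * Real.exp (|τ.re| * |x|) := by positivity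
  calc ‖Complex.exp (τ * ((x : ℂ) + (θ : ℂ) * I))‖ * ‖Lap ρ (Complex.cosh ((x : ℂ) + (θ : ℂ) * I))‖
      ≤ (Real.exp (|τ.im| * (π / 2)) * Real.exp (|τ.re| * |x|)) *
          ((2 * (∫ u, ‖deriv ρ u‖) + (Real.exp 1 * (∫ u, ‖ρ u‖) + 4 * (∫ u, ‖deriv ρ u‖))) * Real.exp (-|x|)) :=
        mul_le_mul hexp hLap (norm_nonneg _) h0
    _ = C * Real.exp (-(1 - |τ.re|) * |x|) := by
        have : Real.exp (|τ.re| * |x|) * Real.exp (-|x|) = Real.exp (-(1 - |τ.re|) * |x|) := by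
          rw [← Real.exp_add]; ring_nf
        simp only [C]; rw [← this]; ring

end IsPosTest

/-- `e^{αR}/sinh R → 0` as `R → ∞` for `α < 1`. [folklore] -/
theorem tendsto_exp_mul_div_sinh {α : ℝ} (hα : α < 1) :
    Tendsto (fun R : ℝ => Real.exp (α * R) / Real.sinh R) atTop (𝓝 0) := by
  have hlim : Tendsto (fun R : ℝ => 4 * Real.exp ((α - 1) * R)) atTop (𝓝 0) := by
    have : Tendsto (fun R : ℝ => (α - 1) * R) atTop atBot :=
      Filter.Tendsto.const_mul_atTop_of_neg (by linarith : α - 1 < 0) tendsto_id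
    have h2 := Real.tendsto_exp_atBot.comp this
    simpa using h2.const_mul 4
  refine squeeze_zero' ?_ ?_ hlim
  · filter_upwards [eventually_ge_atTop (1 : ℝ)] with R hR
    exact div_nonneg (Real.exp_pos _).le (Real.sinh_pos_iff.2 (by linarith)).le
  · filter_upwards [eventually_ge_atTop (1 : ℝ)] with R hR
    have hs : Real.exp R / 4 ≤ Real.sinh R := by
      rw [Real.sinh_eq]
      have e2 : (2 : ℝ) ≤ Real.exp (2 * R) := by have := Real.add_one_le_exp (2 * R); linarith
      have e3 : Real.exp (2 * R) = Real.exp R * Real.exp R := by rw [← Real.exp_add]; ring_nf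
      have e4 : Real.exp (-R) * Real.exp R = 1 := by rw [← Real.exp_add]; simp
      nlinarith [Real.exp_pos (-R), Real.exp_pos R]
    have hspos : 0 < Real.sinh R := Real.sinh_pos_iff.2 (by linarith)
    rw [div_le_iff₀ hspos]
    have e : 4 * Real.exp ((α - 1) * R) * (Real.exp R / 4) = Real.exp (α * R) := by
      rw [show 4 * Real.exp ((α - 1) * R) * (Real.exp R / 4) = Real.exp ((α - 1) * R) * Real.exp R by ring,
        ← Real.exp_add]; ring_nf
    calc Real.exp (α * R) = 4 * Real.exp ((α - 1) * R) * (Real.exp R / 4) := e.symm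
      _ ≤ 4 * Real.exp ((α - 1) * R) * Real.sinh R := by gcongr

namespace IsPosTest

variable {ρ : ℝ → ℂ} {a b : ℝ} (h : IsPosTest ρ a b)
include h

/-- **The contour shift** `∫_ℝ G_τ(x) dx = ∫_ℝ G_τ(x + iθ) dx` for `θ = ±π/2` and `|Re τ| < 1`
(Cauchy's theorem on the rectangles `[-R, R] × [0, θ]`, `R → ∞`). [folklore] -/
theorem integral_Gτ_shift (τ : ℂ) (hτ : |τ.re| < 1) (θ : ℝ) (hθ : θ = π / 2 ∨ θ = -(π / 2)) :
    ∫ x : ℝ, Gτ ρ τ ((x : ℂ) + ((0 : ℝ) : ℂ) * I) = ∫ x : ℝ, Gτ ρ τ ((x : ℂ) + (θ : ℂ) * I) := by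
  have hdiff := h.differentiable_Gτ τ
  -- the rectangle identity for every `R`
  have hrect : ∀ R : ℝ,
      (∫ x in (-R : ℝ)..R, Gτ ρ τ ((x : ℂ) + ((0 : ℝ) : ℂ) * I)) - (∫ x in (-R : ℝ)..R, Gτ ρ τ ((x : ℂ) + (θ : ℂ) * I)) +
        I • (∫ y in (0 : ℝ)..θ, Gτ ρ τ ((((1 : ℝ) * R : ℝ) : ℂ) + (y : ℂ) * I)) -
        I • (∫ y in (0 : ℝ)..θ, Gτ ρ τ ((((-1 : ℝ) * R : ℝ) : ℂ) + (y : ℂ) * I)) = 0 := by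
    intro R
    have key := Complex.integral_boundary_rect_eq_zero_of_differentiableOn (Gτ ρ τ) ((-R : ℝ) : ℂ)
      ((R : ℂ) + (θ : ℂ) * I) hdiff.differentiableOn
    simp only [Complex.ofReal_re, Complex.ofReal_im, Complex.add_re, Complex.add_im, Complex.mul_re,
      Complex.mul_im, Complex.I_re, Complex.I_im, mul_zero, mul_one, sub_zero, add_zero, zero_add] at key
    have e1 : ((1 : ℝ) * R : ℝ) = R := one_mul R
    have e2 : ((-1 : ℝ) * R : ℝ) = -R := neg_one_mul R
    rw [e1, e2]
    convert key using 3
  -- limits of the four pieces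
  have hi0 := h.integrable_Gτ_line τ hτ 0 (Or.inl rfl)
  have hiθ := h.integrable_Gτ_line τ hτ θ (Or.inr hθ)
  have hT1 : Tendsto (fun R : ℝ => ∫ x in (-R : ℝ)..R, Gτ ρ τ ((x : ℂ) + ((0 : ℝ) : ℂ) * I)) atTop
      (𝓝 (∫ x : ℝ, Gτ ρ τ ((x : ℂ) + ((0 : ℝ) : ℂ) * I))) :=
    intervalIntegral_tendsto_integral hi0 tendsto_neg_atTop_atBot tendsto_id
  have hT2 : Tendsto (fun R : ℝ => ∫ x in (-R : ℝ)..R, Gτ ρ τ ((x : ℂ) + (θ : ℂ) * I)) atTop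
      (𝓝 (∫ x : ℝ, Gτ ρ τ ((x : ℂ) + (θ : ℂ) * I))) :=
    intervalIntegral_tendsto_integral hiθ tendsto_neg_atTop_atBot tendsto_id
  have hV : ∀ σ : ℝ, σ = 1 ∨ σ = -1 →
      Tendsto (fun R : ℝ => I • ∫ y in (0 : ℝ)..θ, Gτ ρ τ (((σ * R : ℝ) : ℂ) + (y : ℂ) * I)) atTop (𝓝 0) := by
    intro σ hσ
    rw [tendsto_zero_iff_norm_tendsto_zero]
    have hlim : Tendsto (fun R : ℝ => (π / 2) * (Real.exp (|τ.im| * (π / 2)) * (∫ u, ‖deriv ρ u‖)) *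
        (Real.exp (|τ.re| * R) / Real.sinh R)) atTop (𝓝 0) := by
      simpa using (tendsto_exp_mul_div_sinh hτ).const_mul ((π / 2) * (Real.exp (|τ.im| * (π / 2)) * (∫ u, ‖deriv ρ u‖)))
    refine squeeze_zero' (Eventually.of_forall fun R => norm_nonneg _) ?_ hlim
    filter_upwards [eventually_ge_atTop (1 : ℝ)] with R hR
    rw [norm_smul, Complex.norm_I, one_mul]
    refine (h.norm_integral_vertical_le τ hR σ hσ θ hθ).trans (le_of_eq ?_)
    rw [Real.exp_add]; ring
  have hsum : Tendsto (fun R : ℝ =>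
      (∫ x in (-R : ℝ)..R, Gτ ρ τ ((x : ℂ) + ((0 : ℝ) : ℂ) * I)) - (∫ x in (-R : ℝ)..R, Gτ ρ τ ((x : ℂ) + (θ : ℂ) * I)) +
        I • (∫ y in (0 : ℝ)..θ, Gτ ρ τ ((((1 : ℝ) * R : ℝ) : ℂ) + (y : ℂ) * I)) -
        I • (∫ y in (0 : ℝ)..θ, Gτ ρ τ ((((-1 : ℝ) * R : ℝ) : ℂ) + (y : ℂ) * I))) atTop
      (𝓝 ((∫ x : ℝ, Gτ ρ τ ((x : ℂ) + ((0 : ℝ) : ℂ) * I)) - (∫ x : ℝ, Gτ ρ τ ((x : ℂ) + (θ : ℂ) * I)) + 0 - 0)) :=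
    ((hT1.sub hT2).add (hV 1 (Or.inl rfl))).sub (hV (-1) (Or.inr rfl))
  have hzero : Tendsto (fun R : ℝ =>
      (∫ x in (-R : ℝ)..R, Gτ ρ τ ((x : ℂ) + ((0 : ℝ) : ℂ) * I)) - (∫ x in (-R : ℝ)..R, Gτ ρ τ ((x : ℂ) + (θ : ℂ) * I)) +
        I • (∫ y in (0 : ℝ)..θ, Gτ ρ τ ((((1 : ℝ) * R : ℝ) : ℂ) + (y : ℂ) * I)) -
        I • (∫ y in (0 : ℝ)..θ, Gτ ρ τ ((((-1 : ℝ) * R : ℝ) : ℂ) + (y : ℂ) * I))) atTop (𝓝 0) := by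
    simp only [hrect]; exact tendsto_const_nhds
  have := tendsto_nhds_unique hsum hzero
  rw [add_zero, sub_zero, sub_eq_zero] at this
  exact this

end IsPosTest

/-- `∫ g(-x) dx = ∫ g(x) dx` on `ℝ`. [folklore] -/
theorem integral_comp_neg_real (g : ℝ → ℂ) : ∫ x : ℝ, g (-x) = ∫ x : ℝ, g x := by
  have A : MeasurableEmbedding fun x : ℝ => -x := (Homeomorph.neg ℝ).measurableEmbedding
  have := A.integral_map (μ := volume) g
  rw [Measure.map_neg_eq_self (volume : Measure ℝ)] at this
  exact this.symm

/-- The cosine transform `P_ρ(s) = ∫ cos(sx) ρ(x) dx`. [folklore] -/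
def Pc (ρ : ℝ → ℂ) (s : ℝ) : ℂ := ∫ x : ℝ, (Real.cos (s * x) : ℂ) * ρ x

namespace IsPosTest

variable {ρ : ℝ → ℂ} {a b : ℝ} (h : IsPosTest ρ a b)
include h

/-- `𝓛ρ(is) + 𝓛ρ(-is) = 2 P_ρ(s)`. [folklore] -/
theorem Lap_I_add_Lap_neg_I (s : ℝ) : Lap ρ (I * s) + Lap ρ (-I * s) = 2 * Pc ρ s := by
  have hi : ∀ w : ℂ, Integrable fun x : ℝ => Complex.exp (-(x : ℂ) * w) * ρ x := fun w =>
    ((Complex.continuous_exp.comp (by fun_prop)).mul h.continuous).integrable_of_hasCompactSupport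
      h.hasCompactSupport.mul_left
  unfold Lap Pc
  rw [← integral_add (hi _) (hi _), ← integral_const_mul]
  refine integral_congr_ae (Eventually.of_forall fun x => ?_)
  dsimp only
  have : (Real.cos (s * x) : ℂ) = (Complex.exp (-(x : ℂ) * (I * s)) + Complex.exp (-(x : ℂ) * (-I * s))) / 2 := by
    rw [Complex.ofReal_cos, Complex.cos]; push_cast; ring_nf
  rw [this]; ring

omit h in
/-- The values of `G_τ` on the three lines. [folklore] -/
theorem Gτ_line_zero (τ : ℂ) (x : ℝ) : Gτ ρ τ ((x : ℂ) + ((0 : ℝ) : ℂ) * I) = Complex.exp (τ * x) * Lap ρ (Real.cosh x : ℂ) := by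
  unfold Gτ; rw [Complex.ofReal_zero, zero_mul, add_zero, Complex.ofReal_cosh]

omit h in
/-- `G_τ(x + iπ/2) = e^{iπτ/2} e^{τx} 𝓛ρ(i sinh x)`. [folklore] -/
theorem Gτ_line_up (τ : ℂ) (x : ℝ) :
    Gτ ρ τ ((x : ℂ) + ((π / 2 : ℝ) : ℂ) * I) = Complex.exp (I * (π / 2) * τ) * (Complex.exp (τ * x) * Lap ρ (I * Real.sinh x)) := by
  unfold Gτ; rw [cosh_add_pi_half_mul_I, mul_add, Complex.exp_add]; push_cast; ring

omit h in
/-- `G_τ(x - iπ/2) = e^{-iπτ/2} e^{τx} 𝓛ρ(-i sinh x)`. [folklore] -/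
theorem Gτ_line_down (τ : ℂ) (x : ℝ) :
    Gτ ρ τ ((x : ℂ) + ((-(π / 2) : ℝ) : ℂ) * I) = Complex.exp (-(I * (π / 2) * τ)) * (Complex.exp (τ * x) * Lap ρ (-I * Real.sinh x)) := by
  unfold Gτ; rw [cosh_sub_pi_half_mul_I, mul_add, Complex.exp_add]; push_cast; ring_nf

/-- **The basic identity**: `cos(πτ/2) ∫ e^{τx} 𝓛ρ(cosh x) dx = ∫ e^{τx} P_ρ(sinh x) dx` for `|Re τ| < 1`.
[folklore] -/
theorem cos_mul_integral_Lap_cosh (τ : ℂ) (hτ : |τ.re| < 1) :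
    Complex.cos (π / 2 * τ) * ∫ x : ℝ, Complex.exp (τ * x) * Lap ρ (Real.cosh x : ℂ) =
      ∫ x : ℝ, Complex.exp (τ * x) * Pc ρ (Real.sinh x) := by
  have hup := h.integral_Gτ_shift τ hτ (π / 2) (Or.inl rfl)
  have hdn := h.integral_Gτ_shift τ hτ (-(π / 2)) (Or.inr rfl)
  simp only [Gτ_line_zero, Gτ_line_up, Gτ_line_down] at hup hdn
  rw [integral_const_mul] at hup hdn
  set I₀ := ∫ x : ℝ, Complex.exp (τ * x) * Lap ρ (Real.cosh x : ℂ) with hI₀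
  set Jp := ∫ x : ℝ, Complex.exp (τ * x) * Lap ρ (I * Real.sinh x) with hJp
  set Jm := ∫ x : ℝ, Complex.exp (τ * x) * Lap ρ (-I * Real.sinh x) with hJm
  -- integrability of the two `J` integrands
  have hiθ : ∀ θ, θ = π / 2 ∨ θ = -(π / 2) → Integrable fun x : ℝ => Gτ ρ τ ((x : ℂ) + (θ : ℂ) * I) :=
    fun θ hθ => h.integrable_Gτ_line τ hτ θ (Or.inr hθ)
  have hiJp : Integrable fun x : ℝ => Complex.exp (τ * x) * Lap ρ (I * Real.sinh x) := by
    have := (hiθ _ (Or.inl rfl)).const_mul (Complex.exp (-(I * (π / 2) * τ)))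
    refine this.congr (Eventually.of_forall fun x => ?_)
    simp only [Gτ_line_up]
    rw [← mul_assoc, ← Complex.exp_add, neg_add_cancel, Complex.exp_zero, one_mul]
  have hiJm : Integrable fun x : ℝ => Complex.exp (τ * x) * Lap ρ (-I * Real.sinh x) := by
    have := (hiθ _ (Or.inr rfl)).const_mul (Complex.exp (I * (π / 2) * τ))
    refine this.congr (Eventually.of_forall fun x => ?_)
    simp only [Gτ_line_down]
    rw [← mul_assoc, ← Complex.exp_add, add_neg_cancel, Complex.exp_zero, one_mul]
  -- `Jp + Jm = 2 ∫ e^{τx} P(sinh x)`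
  have hsum : Jp + Jm = 2 * ∫ x : ℝ, Complex.exp (τ * x) * Pc ρ (Real.sinh x) := by
    rw [hJp, hJm, ← integral_add hiJp hiJm, ← integral_const_mul]
    refine integral_congr_ae (Eventually.of_forall fun x => ?_)
    dsimp only
    rw [← mul_add, h.Lap_I_add_Lap_neg_I]; ring
  -- `I₀ = e^{iπτ/2} Jp = e^{-iπτ/2} Jm`
  have e1 : Complex.exp (-(I * (π / 2) * τ)) * I₀ = Jp := by
    rw [hup, ← mul_assoc, ← Complex.exp_add, neg_add_cancel, Complex.exp_zero, one_mul]
  have e2 : Complex.exp (I * (π / 2) * τ) * I₀ = Jm := by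
    rw [hdn, ← mul_assoc, ← Complex.exp_add, add_neg_cancel, Complex.exp_zero, one_mul]
  have hcos : Complex.cos (π / 2 * τ) = (Complex.exp (I * (π / 2) * τ) + Complex.exp (-(I * (π / 2) * τ))) / 2 := by
    rw [Complex.cos]; ring_nf
  rw [hcos]
  have : (Complex.exp (I * (π / 2) * τ) + Complex.exp (-(I * (π / 2) * τ))) / 2 * I₀ = (Jm + Jp) / 2 := by
    rw [← e1, ← e2]; ring
  rw [this, add_comm, hsum]; ring

omit h in
/-- Averaging an even integrand against `e^{τx}`: `∫ e^{τx} f = ∫ ((e^{τx} + e^{-τx})/2) f` for even `f`. [folklore] -/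
theorem integral_cexp_mul_even (τ : ℂ) {f : ℝ → ℂ} (hf : ∀ x, f (-x) = f x)
    (hi : Integrable fun x : ℝ => Complex.exp (τ * x) * f x) :
    ∫ x : ℝ, Complex.exp (τ * x) * f x = ∫ x : ℝ, (Complex.exp (τ * x) + Complex.exp (-(τ * x))) / 2 * f x := by
  have h1 : ∫ x : ℝ, Complex.exp (τ * x) * f x = ∫ x : ℝ, Complex.exp (-(τ * x)) * f x := by
    rw [← integral_comp_neg_real]
    refine integral_congr_ae (Eventually.of_forall fun x => ?_)
    dsimp only; rw [hf]; push_cast; ring_nf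
  have hi' : Integrable fun x : ℝ => Complex.exp (-(τ * x)) * f x := by
    have := hi.comp_neg
    refine this.congr (Eventually.of_forall fun x => ?_)
    dsimp only; rw [hf]; push_cast; ring_nf
  have h2 : ∫ x : ℝ, (Complex.exp (τ * x) + Complex.exp (-(τ * x))) / 2 * f x =
      ((∫ x : ℝ, Complex.exp (τ * x) * f x) + ∫ x : ℝ, Complex.exp (-(τ * x)) * f x) / 2 := by
    rw [← integral_add hi hi', ← integral_div]
    refine integral_congr_ae (Eventually.of_forall fun x => ?_)
    dsimp only; ring
  rw [h2, ← h1]; ring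

omit h in
/-- `P_ρ(sinh x)` is even in `x`. [folklore] -/
theorem Pc_sinh_even (x : ℝ) : Pc ρ (Real.sinh (-x)) = Pc ρ (Real.sinh x) := by
  unfold Pc; rw [Real.sinh_neg]
  refine integral_congr_ae (Eventually.of_forall fun u => ?_)
  dsimp only; rw [neg_mul, Real.cos_neg]

/-- `P_ρ(s) = (𝓛ρ(is) + 𝓛ρ(-is))/2`, hence `‖P_ρ(sinh x)‖ ≤ (e‖ρ‖₁ + 4‖ρ'‖₁) e^{-|x|}`. [folklore] -/
theorem norm_Pc_sinh_le (x : ℝ) :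
    ‖Pc ρ (Real.sinh x)‖ ≤ (Real.exp 1 * (∫ u, ‖ρ u‖) + 4 * (∫ u, ‖deriv ρ u‖)) * Real.exp (-|x|) := by
  have e : Pc ρ (Real.sinh x) = (Lap ρ (I * Real.sinh x) + Lap ρ (-I * Real.sinh x)) / 2 := by
    rw [h.Lap_I_add_Lap_neg_I]; ring
  rw [e, norm_div, Complex.norm_two]
  have h1 := h.norm_Lap_I_sinh_le x I (Or.inl rfl)
  have h2 := h.norm_Lap_I_sinh_le x (-I) (Or.inr rfl)
  calc ‖Lap ρ (I * Real.sinh x) + Lap ρ (-I * Real.sinh x)‖ / 2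
      ≤ (‖Lap ρ (I * Real.sinh x)‖ + ‖Lap ρ (-I * Real.sinh x)‖) / 2 := by gcongr; exact norm_add_le _ _
    _ ≤ _ := by linarith

/-- `x ↦ P_ρ(sinh x)` is continuous. [folklore] -/
theorem continuous_Pc_sinh : Continuous fun x : ℝ => Pc ρ (Real.sinh x) := by
  have e : (fun x : ℝ => Pc ρ (Real.sinh x)) = fun x => (Lap ρ (I * Real.sinh x) + Lap ρ (-I * Real.sinh x)) / 2 := by
    funext x; rw [h.Lap_I_add_Lap_neg_I]; ring
  rw [e]
  have hL := h.differentiable_Lap.continuous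
  exact ((hL.comp (by fun_prop)).add (hL.comp (by fun_prop))).div_const _

/-- Integrability of `e^{τx} P_ρ(sinh x)` for `|Re τ| < 1`. [folklore] -/
theorem integrable_cexp_mul_Pc_sinh (τ : ℂ) (hτ : |τ.re| < 1) :
    Integrable fun x : ℝ => Complex.exp (τ * x) * Pc ρ (Real.sinh x) := by
  have hb : 0 < 1 - |τ.re| := by linarith
  set C := Real.exp 1 * (∫ u, ‖ρ u‖) + 4 * (∫ u, ‖deriv ρ u‖)
  have hc : Continuous fun x : ℝ => Complex.exp (τ * x) * Pc ρ (Real.sinh x) :=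
    (Complex.continuous_exp.comp (by fun_prop)).mul h.continuous_Pc_sinh
  refine ((integrable_exp_neg_mul_abs' hb).const_mul C).mono' hc.aestronglyMeasurable ?_
  refine Eventually.of_forall fun x => ?_
  rw [norm_mul]
  have h1 := norm_cexp_mul_ofReal_le τ x
  have h2 := h.norm_Pc_sinh_le x
  have h0 : 0 ≤ C * Real.exp (-|x|) := by positivity
  calc ‖Complex.exp (τ * x)‖ * ‖Pc ρ (Real.sinh x)‖ ≤ Real.exp (|τ.re| * |x|) * (C * Real.exp (-|x|)) :=
        mul_le_mul h1 h2 (norm_nonneg _) (Real.exp_pos _).le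
    _ = C * Real.exp (-(1 - |τ.re|) * |x|) := by
        have : Real.exp (|τ.re| * |x|) * Real.exp (-|x|) = Real.exp (-(1 - |τ.re|) * |x|) := by
          rw [← Real.exp_add]; ring_nf
        rw [← this]; ring

/-- **`cosh(πt) ∫ e^{2itx} 𝓛ρ(cosh x) dx = ∫ cos(2tx) P_ρ(sinh x) dx`** (`t` real). [folklore] -/
theorem cosh_mul_integral_Lap_cosh (t : ℝ) :
    (Real.cosh (π * t) : ℂ) * ∫ x : ℝ, Complex.exp (2 * t * I * x) * Lap ρ (Real.cosh x : ℂ) =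
      ∫ x : ℝ, (Real.cos (2 * t * x) : ℂ) * Pc ρ (Real.sinh x) := by
  have hτ : |(2 * t * I : ℂ).re| < 1 := by simp
  have key := h.cos_mul_integral_Lap_cosh (2 * t * I) hτ
  have hcos : Complex.cos (π / 2 * (2 * t * I)) = (Real.cosh (π * t) : ℂ) := by
    rw [show (π : ℂ) / 2 * (2 * t * I) = (π * t : ℂ) * I by ring, Complex.cos_mul_I, ← Complex.ofReal_mul, Complex.ofReal_cosh]
  rw [hcos] at key
  rw [key]
  -- symmetrize the right side
  have hi : Integrable fun x : ℝ => Complex.exp (2 * t * I * x) * Pc ρ (Real.sinh x) :=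
    h.integrable_cexp_mul_Pc_sinh (2 * t * I) hτ
  rw [integral_cexp_mul_even (2 * t * I) (fun x => Pc_sinh_even (ρ := ρ) x) hi]
  refine integral_congr_ae (Eventually.of_forall fun x => ?_)
  dsimp only
  congr 1
  rw [Complex.ofReal_cos, Complex.cos]; push_cast; ring_nf

end IsPosTest

namespace IsPosTest

variable {ρ : ℝ → ℂ} {a b : ℝ} (h : IsPosTest ρ a b)
include h

/-- **`cos(πy) ∫ e^{2yx} 𝓛ρ(cosh x) dx = ∫ cosh(2yx) P_ρ(sinh x) dx`** (`|y| < 1/2`). [folklore] -/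
theorem cos_mul_integral_Lap_cosh_real {y : ℝ} (hy : |y| < 1 / 2) :
    (Real.cos (π * y) : ℂ) * ∫ x : ℝ, Complex.exp ((2 * y : ℝ) * x) * Lap ρ (Real.cosh x : ℂ) =
      ∫ x : ℝ, (Real.cosh (2 * y * x) : ℂ) * Pc ρ (Real.sinh x) := by
  have hτ : |((2 * y : ℝ) : ℂ).re| < 1 := by
    rw [Complex.ofReal_re, abs_mul, abs_two]; linarith
  have key := h.cos_mul_integral_Lap_cosh ((2 * y : ℝ) : ℂ) hτ
  have hcos : Complex.cos (π / 2 * ((2 * y : ℝ) : ℂ)) = (Real.cos (π * y) : ℂ) := by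
    rw [show (π : ℂ) / 2 * ((2 * y : ℝ) : ℂ) = ((π * y : ℝ) : ℂ) by push_cast; ring, ← Complex.ofReal_cos]
  rw [hcos] at key
  rw [key, integral_cexp_mul_even _ (fun x => Pc_sinh_even (ρ := ρ) x) (h.integrable_cexp_mul_Pc_sinh _ hτ)]
  refine integral_congr_ae (Eventually.of_forall fun x => ?_)
  dsimp only
  congr 1
  rw [Complex.ofReal_cosh, Complex.cosh]; push_cast; ring_nf

/-! ### The `K`-Bessel side: `∫ e^{τx} 𝓛ρ(cosh x) dx = 2 ∫ K_τ(u) ρ(u) du` -/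

omit h in
/-- `e^{u} ≥ u²/4` for `u ≥ 0`. [folklore] -/
private theorem sq_div_four_le_exp {u : ℝ} (hu : 0 ≤ u) : u ^ 2 / 4 ≤ Real.exp u := by
  have h1 : 1 + u / 2 ≤ Real.exp (u / 2) := by have := Real.add_one_le_exp (u / 2); linarith
  have h2 : Real.exp u = Real.exp (u / 2) ^ 2 := by rw [← Real.exp_nat_mul]; ring_nf
  have h3 : (1 + u / 2) ^ 2 ≤ Real.exp (u / 2) ^ 2 := pow_le_pow_left₀ (by linarith) h1 2
  nlinarith

omit h in
/-- `c|x| - a cosh x ≤ 2(c+1)²/a - |x|` for `a > 0`. [folklore] -/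
theorem linear_sub_cosh_le {a : ℝ} (ha : 0 < a) (c x : ℝ) :
    c * |x| - a * Real.cosh x ≤ 2 * (c + 1) ^ 2 / a - |x| := by
  have hch : Real.exp |x| / 2 ≤ Real.cosh x := by
    have := exp_abs_le_two_mul_cosh' x
    linarith
  have hexp : |x| ^ 2 / 4 ≤ Real.exp |x| := sq_div_four_le_exp (abs_nonneg x)
  -- `(c+1)|x| - (a/8)|x|² ≤ 2(c+1)²/a`
  have key : (c + 1) * |x| - a / 8 * |x| ^ 2 ≤ 2 * (c + 1) ^ 2 / a := by
    have h0 : 0 ≤ a / 8 * (|x| - 4 * (c + 1) / a) ^ 2 := by positivity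
    have e : a / 8 * (|x| - 4 * (c + 1) / a) ^ 2 = a / 8 * |x| ^ 2 - (c + 1) * |x| + 2 * (c + 1) ^ 2 / a := by
      field_simp; ring
    linarith
  nlinarith

end IsPosTest

namespace IsPosTest

variable {ρ : ℝ → ℂ} {a b : ℝ} (h : IsPosTest ρ a b)
include h

open Literature.Analysis.FunctionSpaces in
/-- **The `K`-Bessel side**: `∫ e^{τx} 𝓛ρ(cosh x) dx = 2 ∫ K_τ(u) ρ(u) du` (Fubini and the tree's
`2 K_ν(u) = ∫_ℝ e^{-u cosh t} e^{νt} dt`). [cite: BatemanGrosswald1964, §1 (2)] -/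
theorem integral_cexp_mul_Lap_cosh_eq_besselK (τ : ℂ) :
    ∫ x : ℝ, Complex.exp (τ * x) * Lap ρ (Real.cosh x : ℂ) = 2 * ∫ u : ℝ, besselK τ u * ρ u := by
  set F : ℝ → ℝ → ℂ := fun x u => Complex.exp (τ * x) * (Complex.exp (-(u : ℂ) * (Real.cosh x : ℂ)) * ρ u) with hF
  -- the left side as an iterated integral
  have hL : ∫ x : ℝ, Complex.exp (τ * x) * Lap ρ (Real.cosh x : ℂ) = ∫ x : ℝ, ∫ u : ℝ, F x u := by
    refine integral_congr_ae (Eventually.of_forall fun x => ?_)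
    simp only [hF, Lap]
    rw [← integral_const_mul]
  -- integrability on the product
  set C : ℝ := 2 * (|τ.re| + 1) ^ 2 / a with hC
  have hint : Integrable (Function.uncurry F) ((volume : Measure ℝ).prod volume) := by
    have hm : Continuous (Function.uncurry F) := by
      simp only [hF]
      have hρ := h.continuous
      fun_prop
    have hmaj : Integrable (fun p : ℝ × ℝ => (Real.exp C * Real.exp (-1 * |p.1|)) * ‖ρ p.2‖) ((volume : Measure ℝ).prod volume) :=
      (((integrable_exp_neg_mul_abs' one_pos).const_mul (Real.exp C)).mul_prod h.integrable.norm)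
    refine hmaj.mono' hm.aestronglyMeasurable (Eventually.of_forall fun p => ?_)
    rcases p with ⟨x, u⟩
    simp only [Function.uncurry, hF, norm_mul]
    rcases em (u ∈ Set.Icc a b) with hu | hu
    · have hua : a ≤ u := hu.1
      have h1 : ‖Complex.exp (τ * x)‖ ≤ Real.exp (|τ.re| * |x|) := norm_cexp_mul_ofReal_le τ x
      have h2 : ‖Complex.exp (-(u : ℂ) * (Real.cosh x : ℂ))‖ ≤ Real.exp (-(a * Real.cosh x)) := by
        rw [Complex.norm_exp]
        apply Real.exp_le_exp.2
        have : (-(u : ℂ) * (Real.cosh x : ℂ)).re = -(u * Real.cosh x) := by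
          rw [← Complex.ofReal_neg, ← Complex.ofReal_mul, Complex.ofReal_re]; ring
        rw [this]
        have := Real.cosh_pos x
        nlinarith
      have h3 : Real.exp (|τ.re| * |x|) * Real.exp (-(a * Real.cosh x)) ≤ Real.exp C * Real.exp (-1 * |x|) := by
        rw [← Real.exp_add, ← Real.exp_add]
        apply Real.exp_le_exp.2
        have := linear_sub_cosh_le h.pos |τ.re| x
        rw [hC]; linarith
      have h0 : 0 ≤ ‖ρ u‖ := norm_nonneg _
      calc ‖Complex.exp (τ * x)‖ * (‖Complex.exp (-(u : ℂ) * (Real.cosh x : ℂ))‖ * ‖ρ u‖)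
          = (‖Complex.exp (τ * x)‖ * ‖Complex.exp (-(u : ℂ) * (Real.cosh x : ℂ))‖) * ‖ρ u‖ := by ring
        _ ≤ (Real.exp (|τ.re| * |x|) * Real.exp (-(a * Real.cosh x))) * ‖ρ u‖ :=
            mul_le_mul_of_nonneg_right (mul_le_mul h1 h2 (norm_nonneg _) (Real.exp_pos _).le) h0
        _ ≤ (Real.exp C * Real.exp (-1 * |x|)) * ‖ρ u‖ := mul_le_mul_of_nonneg_right h3 h0
    · rw [h.eq_zero hu, norm_zero, mul_zero, mul_zero, mul_zero]
  have hswap := MeasureTheory.integral_integral_swap hint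
  rw [hL, hswap, ← integral_const_mul]
  refine integral_congr_ae (Eventually.of_forall fun u => ?_)
  dsimp only
  rcases em (u ∈ Set.Icc a b) with hu | hu
  · have hu0 : 0 < u := h.pos.trans_le hu.1
    have hK := two_mul_besselK_eq_integral hu0 τ
    simp only [hF]
    calc ∫ x : ℝ, Complex.exp (τ * x) * (Complex.exp (-(u : ℂ) * (Real.cosh x : ℂ)) * ρ u)
        = (∫ x : ℝ, Complex.exp (-(u : ℂ) * (Real.cosh x : ℂ)) * Complex.exp (τ * x)) * ρ u := by
          rw [← integral_mul_const]
          refine integral_congr_ae (Eventually.of_forall fun x => ?_); dsimp only; ring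
      _ = 2 * besselK τ u * ρ u := by rw [← hK]
      _ = 2 * (besselK τ u * ρ u) := by ring
  · simp only [hF, h.eq_zero hu, mul_zero, integral_zero]

end IsPosTest

/-! ### The bridge for `ρ = φ/x` -/

/-- For `φ ∈ C¹` supported in `[a, b] ⊂ (0, ∞)`, `x ↦ φ(x)/x` is a test function `IsPosTest`. [folklore] -/
theorem isPosTest_div {φ : ℝ → ℂ} {a b : ℝ} (ha : 0 < a) (hab : a ≤ b) (hφ : ContDiff ℝ 1 φ)
    (hsupp : ∀ x, φ x ≠ 0 → x ∈ Set.Icc a b) : IsPosTest (fun x => φ x / (x : ℂ)) a b := by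
  refine ⟨ha, hab, ?_, fun x hx => hsupp x (fun h0 => hx (by rw [h0, zero_div]))⟩
  rw [contDiff_iff_contDiffAt]
  intro x
  by_cases hx : x < a
  · have hev : (fun y : ℝ => φ y / (y : ℂ)) =ᶠ[𝓝 x] fun _ => 0 := by
      filter_upwards [Iio_mem_nhds hx] with y hy
      have : φ y = 0 := by
        by_contra hne; exact absurd (hsupp y hne).1 (not_le.2 hy)
      rw [this, zero_div]
    exact contDiffAt_const.congr_of_eventuallyEq hev
  · have hx0 : (x : ℂ) ≠ 0 := by
      have : 0 < x := ha.trans_le (not_lt.1 hx)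
      exact_mod_cast this.ne'
    have hinv : ContDiffAt ℝ 1 (fun y : ℝ => (y : ℂ)⁻¹) x :=
      (contDiffAt_inv ℝ hx0).comp x Complex.ofRealCLM.contDiff.contDiffAt
    have := hφ.contDiffAt.mul hinv
    simpa only [div_eq_mul_inv] using this

open Literature.Analysis.FunctionSpaces in
/-- **The `K`-Bessel bridge, imaginary order** (the content of `cosh(πt) K_{2it}(x) = ∫₀^∞ cos(x sinh ξ) cos(2tξ) dξ`
[Watson1944, §6.22; DeshouillersIwaniec1982, p. 264], integrated against `φ(x) dx/x`): for
`φ ∈ C¹` supported in `[a, b] ⊂ (0, ∞)` and real `t`,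
`8 cosh(πt) ∫₀^∞ K_{2it}(x) φ(x) dx/x = 4 ∫_ℝ cos(2tξ) (∫ cos(x sinh ξ) φ(x) dx/x) dξ`.
[cite: DeshouillersIwaniec1982, §7.1 p. 264] -/
theorem besselK_imaginary_bridge {φ : ℝ → ℂ} {a b : ℝ} (ha : 0 < a) (hab : a ≤ b) (hφ : ContDiff ℝ 1 φ)
    (hsupp : ∀ x, φ x ≠ 0 → x ∈ Set.Icc a b) (t : ℝ) :
    8 * (Real.cosh (π * t) : ℂ) * ∫ u in Set.Ioi (0 : ℝ), besselK (2 * t * I) u * (φ u / u) =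
      4 * ∫ ξ : ℝ, (Real.cos (2 * t * ξ) : ℂ) * Pc (fun x => φ x / (x : ℂ)) (Real.sinh ξ) := by
  have hρ := isPosTest_div ha hab hφ hsupp
  have h1 := hρ.cosh_mul_integral_Lap_cosh t
  have h2 := hρ.integral_cexp_mul_Lap_cosh_eq_besselK (2 * t * I)
  have hset : ∫ u in Set.Ioi (0 : ℝ), besselK (2 * t * I) u * (φ u / u) = ∫ u : ℝ, besselK (2 * t * I) u * (φ u / u) := by
    apply setIntegral_eq_integral_of_forall_compl_eq_zero
    intro u hu
    have : φ u = 0 := by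
      by_contra hne; exact hu (ha.trans_le (hsupp u hne).1)
    rw [this, zero_div, mul_zero]
  rw [hset, ← h1, h2]; ring

open Literature.Analysis.FunctionSpaces in
/-- **The `K`-Bessel bridge, real order** (`|y| < 1/2`):
`8 cos(πy) ∫₀^∞ K_{2y}(x) φ(x) dx/x = 4 ∫_ℝ cosh(2yξ) (∫ cos(x sinh ξ) φ(x) dx/x) dξ` — the value at the
exceptional spectral parameter `t = iy` of the previous identity. [cite: DeshouillersIwaniec1982, §7.1 p. 264–265] -/
theorem besselK_real_bridge {φ : ℝ → ℂ} {a b : ℝ} (ha : 0 < a) (hab : a ≤ b) (hφ : ContDiff ℝ 1 φ)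
    (hsupp : ∀ x, φ x ≠ 0 → x ∈ Set.Icc a b) {y : ℝ} (hy : |y| < 1 / 2) :
    8 * (Real.cos (π * y) : ℂ) * ∫ u in Set.Ioi (0 : ℝ), besselK ((2 * y : ℝ) : ℂ) u * (φ u / u) =
      4 * ∫ ξ : ℝ, (Real.cosh (2 * y * ξ) : ℂ) * Pc (fun x => φ x / (x : ℂ)) (Real.sinh ξ) := by
  have hρ := isPosTest_div ha hab hφ hsupp
  have h1 := hρ.cos_mul_integral_Lap_cosh_real hy
  have h2 := hρ.integral_cexp_mul_Lap_cosh_eq_besselK ((2 * y : ℝ) : ℂ)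
  have hset : ∫ u in Set.Ioi (0 : ℝ), besselK ((2 * y : ℝ) : ℂ) u * (φ u / u) =
      ∫ u : ℝ, besselK ((2 * y : ℝ) : ℂ) u * (φ u / u) := by
    apply setIntegral_eq_integral_of_forall_compl_eq_zero
    intro u hu
    have : φ u = 0 := by
      by_contra hne; exact hu (ha.trans_le (hsupp u hne).1)
    rw [this, zero_div, mul_zero]
  rw [hset, ← h1, h2]; ring

end Literature.NumberTheory.Sieve.BFI.L1.Kuz

/-! ## Corollaries for the concrete transforms `kuzTransforms` -/

namespace Literature.NumberTheory.Sieve.BFI.L1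

open Kuz Literature.Analysis.FunctionSpaces MeasureTheory

/-- `H₋ φ ξ = P_{φ/x}(sinh ξ)`: the profile of `…KuznetsovTransforms` is the cosine transform `Pc`. [folklore] -/
theorem Hm_eq_Pc {X : ℝ} {φ : ℝ → ℂ} (h : Kuz.IsTest X φ) (ξ : ℝ) :
    Kuz.IsTest.Hm φ ξ = Kuz.Pc (fun x => φ x / (x : ℂ)) (Real.sinh ξ) := by
  rw [Kuz.IsTest.Hm, h.Pk_zero_eq_integral_cos]; rfl

/-- The same without the `IsTest` bundle: `Pk φ 0 w = Pc (φ/x) w` needs only integrability, which we have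
for `φ` continuous with compact support. [folklore] -/
theorem Pk_zero_eq_Pc {φ : ℝ → ℂ} (hφ : Continuous φ) (hc : HasCompactSupport φ) (hs : tsupport φ ⊆ Set.Ioi 0) (w : ℝ) :
    Kuz.IsTest.Pk φ 0 w = Kuz.Pc (fun x => φ x / (x : ℂ)) w := by
  -- integrability of `e^{-ivx} ψ₀(x)`
  have hψc : Continuous (Kuz.IsTest.psi φ 0) := by
    -- `ψ₀ = φ/x` is continuous: `φ` vanishes near `0`
    have hcd : ContDiff ℝ 0 fun x : ℝ => φ x / (x : ℂ) := by
      rw [contDiff_iff_contDiffAt]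
      intro x
      by_cases hx : x ≤ 0
      · have hev : (fun y : ℝ => φ y / (y : ℂ)) =ᶠ[nhds x] fun _ => 0 := by
          have hopen : IsOpen (tsupport φ)ᶜ := (isClosed_tsupport φ).isOpen_compl
          have hxmem : x ∈ (tsupport φ)ᶜ := fun hm => absurd (hs hm) (not_lt.2 hx)
          filter_upwards [hopen.mem_nhds hxmem] with y hy
          rw [image_eq_zero_of_notMem_tsupport hy, zero_div]
        exact contDiffAt_const.congr_of_eventuallyEq hev
      · have hx0 : (x : ℂ) ≠ 0 := by exact_mod_cast (ne_of_gt (not_le.1 hx))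
        have hinv : ContDiffAt ℝ 0 (fun y : ℝ => (y : ℂ)⁻¹) x :=
          (contDiffAt_inv ℝ hx0).comp x Complex.ofRealCLM.contDiff.contDiffAt
        have := ((contDiff_zero.2 hφ).contDiffAt).mul hinv
        simpa only [div_eq_mul_inv] using this
    have hcont : Continuous fun x : ℝ => φ x / (x : ℂ) := hcd.continuous
    have e : Kuz.IsTest.psi φ 0 = fun x : ℝ => φ x / (x : ℂ) := by
      funext x; simp [Kuz.IsTest.psi]
    rw [e]; exact hcont
  have hψs : HasCompactSupport (Kuz.IsTest.psi φ 0) := by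
    apply hc.mono'
    intro x hx
    apply subset_tsupport
    rw [Function.mem_support] at hx ⊢
    intro h0; apply hx; simp [Kuz.IsTest.psi, h0]
  have hint : ∀ v : ℝ, Integrable fun x : ℝ => Complex.exp (-(Complex.I * v * x)) * Kuz.IsTest.psi φ 0 x := by
    intro v
    apply (hψc.integrable_of_hasCompactSupport hψs).bdd_mul (c := 1)
    · exact (Complex.continuous_exp.comp (by fun_prop)).aestronglyMeasurable
    · exact Filter.Eventually.of_forall fun x => by rw [Complex.norm_exp]; simp
  rw [Kuz.IsTest.Pk, Kuz.four_eq_integral, Kuz.four_eq_integral, pow_zero, one_mul, ← integral_add (hint w) (hint (-w)),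
    ← integral_div, Kuz.Pc]
  refine integral_congr_ae (Filter.Eventually.of_forall fun x => ?_)
  simp only [Kuz.IsTest.psi, pow_zero, one_mul]
  have : (Real.cos (w * x) : ℂ) = (Complex.exp (-(Complex.I * w * x)) + Complex.exp (-(Complex.I * ↑(-w) * x))) / 2 := by
    rw [Complex.ofReal_cos, Complex.cos]; push_cast; ring_nf
  rw [this]; ring

/-- Support bounds `[a, b] ⊂ (0, ∞)` for an admissible test function. [folklore] -/
theorem exists_Icc_of_admissible {φ : ℝ → ℂ} (hc : HasCompactSupport φ) (hs : tsupport φ ⊆ Set.Ioi 0) :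
    ∃ a b : ℝ, 0 < a ∧ a ≤ b ∧ ∀ x, φ x ≠ 0 → x ∈ Set.Icc a b := by
  by_cases hK : (tsupport φ).Nonempty
  · have hcpt : IsCompact (tsupport φ) := hc
    obtain ⟨a, ha, hamin⟩ := hcpt.exists_isMinOn hK continuous_id.continuousOn
    obtain ⟨b, hb, hbmax⟩ := hcpt.exists_isMaxOn hK continuous_id.continuousOn
    refine ⟨a, b, hs ha, hamin hb, fun x hx => ?_⟩
    have hxK : x ∈ tsupport φ := subset_tsupport _ (Function.mem_support.2 hx)
    exact ⟨hamin hxK, hbmax hxK⟩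
  · refine ⟨1, 1, one_pos, le_rfl, fun x hx => ?_⟩
    exact absurd ⟨x, subset_tsupport _ (Function.mem_support.2 hx)⟩ hK

/-- **`Tmi` is the `K`-Bessel transform of Kuznetsov's formula** ([Drappeau2017, (4.13)], `κ = 0`):
for `φ` smooth with compact support in `(0, ∞)` and real `t`,
`kuzTransforms.Tmi φ t = 8 cosh(πt) ∫₀^∞ K_{2it}(x) φ(x) dx/x` with the tree's `besselK`.
[cite: DeshouillersIwaniec1982, (1.23) & p. 264; Drappeau2017, (4.13)] -/
theorem kuzTransforms_Tmi_eq_besselK {φ : ℝ → ℂ} (hφ : ContDiff ℝ 1 φ) (hc : HasCompactSupport φ)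
    (hs : tsupport φ ⊆ Set.Ioi 0) (t : ℝ) :
    kuzTransforms.Tmi φ t =
      8 * (Real.cosh (Real.pi * t) : ℂ) * ∫ u in Set.Ioi (0 : ℝ), besselK (2 * t * Complex.I) u * (φ u / u) := by
  obtain ⟨a, b, ha, hab, hsupp⟩ := exists_Icc_of_admissible hc hs
  rw [Kuz.besselK_imaginary_bridge ha hab hφ hsupp t]
  show (4 * ∫ ξ : ℝ, (Real.cos (2 * t * ξ) : ℂ) * Kuz.IsTest.Hm φ ξ) = _
  congr 1
  refine integral_congr_ae (Filter.Eventually.of_forall fun ξ => ?_)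
  dsimp only
  rw [Kuz.IsTest.Hm, Pk_zero_eq_Pc hφ.continuous hc hs]

/-- **`TmiX` is `φ̌(iy)`**: for `|y| < 1/2`,
`kuzTransforms.TmiX φ y = 8 cos(πy) ∫₀^∞ K_{2y}(x) φ(x) dx/x`. [cite: DeshouillersIwaniec1982, (1.23) & (7.1); Drappeau2017, (4.13)] -/
theorem kuzTransforms_TmiX_eq_besselK {φ : ℝ → ℂ} (hφ : ContDiff ℝ 1 φ) (hc : HasCompactSupport φ)
    (hs : tsupport φ ⊆ Set.Ioi 0) {y : ℝ} (hy : |y| < 1 / 2) :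
    kuzTransforms.TmiX φ y =
      8 * (Real.cos (Real.pi * y) : ℂ) * ∫ u in Set.Ioi (0 : ℝ), besselK ((2 * y : ℝ) : ℂ) u * (φ u / u) := by
  obtain ⟨a, b, ha, hab, hsupp⟩ := exists_Icc_of_admissible hc hs
  rw [Kuz.besselK_real_bridge ha hab hφ hsupp hy]
  show (4 * ∫ ξ : ℝ, (Real.cosh (2 * y * ξ) : ℂ) * Kuz.IsTest.Hm φ ξ) = _
  congr 1
  refine integral_congr_ae (Filter.Eventually.of_forall fun ξ => ?_)
  dsimp only
  rw [Kuz.IsTest.Hm, Pk_zero_eq_Pc hφ.continuous hc hs]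

/-- The admissible case (`KuzAdmissible φ`). [cite: Drappeau2017, (4.13)] -/
theorem kuzTransforms_Tmi_eq_besselK_of_admissible {φ : ℝ → ℂ} (hφ : KuzAdmissible φ) (t : ℝ) :
    kuzTransforms.Tmi φ t =
      8 * (Real.cosh (Real.pi * t) : ℂ) * ∫ u in Set.Ioi (0 : ℝ), besselK (2 * t * Complex.I) u * (φ u / u) :=
  kuzTransforms_Tmi_eq_besselK (hφ.1.of_le (by exact_mod_cast le_top)) hφ.2.1 hφ.2.2 t

end Literature.NumberTheory.Sieve.BFI.L1
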